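import Summits.AtomisticToContinuum.FouriersLaw.Theses.OddSectorIrreversibility
import Summits.AtomisticToContinuum.FouriersLaw.Theses.TransferKernelPositivity
import Summits.AtomisticToContinuum.FouriersLaw.Theses.FeketeSeriesLaw
import Summits.AtomisticToContinuum.FouriersLaw.Theorems.BoundaryKubo.Negative.Reflection
-- LANDED discharges of the composition's three by-name fixed-`N` hypotheses (lead c3 reshape, 2026-08-16):
import Summits.AtomisticToContinuum.FouriersLaw.Theorems.PuiseuxTransferLedgerFiniteResponseProfile
import Summits.AtomisticToContinuum.FouriersLaw.Theorems.TransferKernelPositivityContactIdentity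
import Summits.AtomisticToContinuum.FouriersLaw.Theorems.OddSectorIrreversibilityBoundedResponseConvergesStubPositiveConductance
-- Checked against (scratch check imports it; not needed by the skeleton itself):
-- import Summits.AtomisticToContinuum.FouriersLaw.Theorems.BoundedResponseConverges.Negative.LoadBearing

/-!
# Crux `BoundedResponseConverges` (stmt-AtomisticToContinuum-9141) — line `comonotone-local-resistance`
# — RESHAPED by lead c3 (2026-08-16): the composition is now UNCONDITIONAL modulo the three stubs

Lead c3 reshape. Since the planner wrote this skeleton, all three by-name fixed-`N` hypotheses of its
composition have been PROVED in tree: `TransferKernelPositivity.FiniteResponseProfile` (stmt-12011; the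
verbatim twin `PuiseuxTransferLedger.FiniteResponseProfile` is closed by
`Theorems.PuiseuxTransferLedgerFiniteResponseProfile.finiteResponseProfile_proof`, which moreover lands the
KDN noise-amplitude representation `θ_{N+1}(i) = (γ/2T²)∫₀^∞ μ₀((p_0² − p_N²)·K_s p_i²) ds`,
`siteResponse_tendsto` — the lean-on of S1 the card listed as "unproved in tree"),
`TransferKernelPositivity.ContactIdentity` (stmt-12015, `Theorems.transferKernelPositivity_contactIdentity_proof`)
and `FeketeSeriesLaw.PositiveConductance` (stmt-11750, `TwoScaleGluingLogRigidity.Stubs.positiveConductance_holds`).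
The planner's composition is kept verbatim as `BoundedResponseConverges_of_items`; the registered composition
`BoundedResponseConverges_of : OddSectorIrreversibility.BoundedResponseConverges` now has NO hypotheses — the
crux follows from the three stubs S1–S3 alone (the only `sorry`s in the file), BY NAME.

STATUS (lead c4, cycle 1, 2026-08-17T02:1xZ). Skeleton re-registered verbatim by c4 (no honest reshape exists: every sufficient stub set carries
the open `N`-uniform half of Fourier's law; 13406 ⇒ S1, S2, S3 landed). No wave this cycle: both delegable stubs were worker-returned `stub-blocked` with
landed bridges (p107451, p107859) and no input has changed. New this cycle: (i) the "accretivity audit" — what positivity of `Sym (−L)⁻¹` gives for the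
transfer column — is already in tree in its sharp form (`IncoherentBounded.conductance_le_half`: `0 < D_N ≤ γ(N−1)/2`, the complete signed `N`-uniform
information; nothing toward S1–S3); (ii) NEMD crossover sweep kit j019536–j019541 (evidence numerics-c4.md): pinnedChain(1,lam,β,1), T = 1,
(lam,β) ∈ {(1,1) N ≤ 256, (0.3,0.3) N ≤ 512 (straddles the ballistic–diffusive crossover), (0.1,0.1) N ≤ 512 (contact-dominated throughout)}:
`D_N` strictly increasing everywhere (no ↓-window), Matthiessen budget `R_N = 2/γ + 2·layer + ρ·N` with the layer TOTAL `r_0+r_1+r_2` converged by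
N = 16 and `ρ` by N = 32; S1 holds with slack 0 at depths 0–2 in every chain; S2's one-sided sign FAILS at depth 1 up to N = 256 (r_1 doubles with N at
all three points while r_0 falls: the layer's internal split is the slowest-converging part of the profile) — `i₁ ≥ 2` is necessary, beyond it nothing
contradicts S2; S3 consistent. LINE PARKS `blocked-on: stmt-13406` (unchanged).

STATUS (lead c3, end of cycle 1, 2026-08-16T18:4xZ). Skeleton registered (stubs `stub_inwardOrdering` S1 / `stub_lengthMonotone`
S2 / `stub_layerBounded` S3; composition `BoundedResponseConverges_of`, closed modulo the stubs). LANDED (all `--supports` stmt-9141):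
`Theorems/…ComonotoneGlue.lean` (p108440: `Glue.exchange_of_limits[_core]`); `Theorems/…StubLayerBounded.lean` (wave-1 worker, p107451:
S3 ⇐ `SpatialCentreManifold.LocalFourierLaw` 13406; S3 ⇐ `ProfileLadder.KapitzaBound` 12676 + `JunctionLocality.ConductanceLowerBound`
11749; fixed-`N` dictionary `r_j^{(N)} = (θ j − θ (j+1))/(γ(1/2 − θ 0))`); `Theorems/…StubLengthMonotone.lean` (wave-1 worker, p107859:
S2 ⇐ `PuiseuxTransferLedger.TwoModeBulk` 12111; S2 ⇐ 13406; S2 ⇐ `ProfileLadder.LocalFourierLaw` 12675 + 11749; harmonic corner EXACT: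
S2 holds with `η = 0` for depths `i ≥ 1` and FAILS at `i = 0`); `Theorems/…ComonotoneComposition.lean` (p117985:
`boundedResponseConverges_of_comonotone : S1 → S2 → S3 → crux` as a theorem, `stub_inwardOrdering_of_localFourierLaw : 13406 → S1`,
`responseProfile_reflect`, `series_law_of_contact`); `Theorems/…ComonotoneTransferColumn.lean` (p118888, KERNEL DICTIONARY
`siteResponse_eq_transferColumn : θ_{N+1}(i) = (γ/T²)∫₀^∞ Cov_{μ₀}(p_0², K_t p_i²) dt − 1/2`); SUBMITTED `Theorems/…ComonotoneFloor.lean`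
(p119117: `conductanceLowerBound_of_inwardOrdering_of_layerBounded : S1 → S3 → ConductanceLowerBound` — the floor is inside S1 ∧ S3 —
and `boundedResponseConverges_of_localFourierLaw : 13406 → crux`). VERDICT: no defect in S1–S3 as typed (both workers' sanity passes);
all three are `N`-uniform SHADOWS of local-Fourier-type open cruxes (13406 suffices for each; 12111 for S2; 12676+11749 for S3) and
strictly weaker than them; no engine for any of them in tree or print (the tree's light-cone / half-chain-locality estimates are
finite-time, the stubs are time-integrated). NUMERICS on the anharmonic chain (NEMD j018364, pinnedChain(1,1,1,1), T = 1, N ≤ 32;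
evidence numerics-c3.md): resistive contact layer decaying geometrically inward (r_0 ≈ 1.39, r_1 ≈ 0.25, r_2 ≈ 0.085, r_3 ≈ 0.04, bulk
ρ ≈ 0.025; ratio ≈ 1/4 per bond) — S1 holds with slack ≈ 0; S2's hard-wired sign is WRONG at depths 0–1 (r_1 grows with N, from below;
the registered S2 survives only via `i₁ ≥ 2` and slack `η_i ≈ e(i) → 0`); S3 consistent. KERNEL FORM (by the dictionary): with
`a_L^{(N)}(i) := (γ/T²)∫₀^∞ Cov_{μ₀}(p_0², K_t p_i²) dt` (ONE equilibrium column of the OPEN `N`-chain at temperature `T`),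
`θ_N(i) = a_L(i) − 1/2`, `D_N = γ(N−1)a_L(N−1)`, `r_i^{(N)} = (a_L(i) − a_L(i+1))/(γ a_L(N−1))`: S1–S3 are shape / two-length /
fixed-depth statements about that column, with no NESS, `δ` or uniqueness inside. LINE PARKS `blocked-on: stmt-13406`.

Planner skeleton (crux-plan, round 1) for the idea card
`Cruxes/BoundedResponseConverges/Ideas/comonotone-local-resistance.md` (ideator 2; triage r1-1/2/3: pass).

OBJECT. For the `N`-chain in linear response let `θ_N(i)` be the kinetic-temperature response
profile (limit of `(μ_{N,T+δ/2,T-δ/2}(p_i²) − μ_{N,T,T}(p_i²))/δ`, `δ → 0`, `δ ≠ 0`; it exists by the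
route item `TransferKernelPositivity.FiniteResponseProfile`, stmt-12011) and `D_N` the clause-(ii)
response coefficient. The LOCAL RESISTANCE of bond `(i, i+1)` is
`r_i^{(N)} := (θ_N(i) − θ_N(i+1)) · (N−1)/D_N` (drop over per-bond current response). Two fixed-`N`
identities hold: the SERIES LAW `(N−1)/D_N = 2/γ + Σ_{i ≤ N−2} r_i^{(N)}` (from the route item
`TransferKernelPositivity.ContactIdentity`, stmt-12015, proved below as `ledger_abstract`) and the
REFLECTION SYMMETRY `r_i^{(N)} = r_{N−2−i}^{(N)}` (from `θ_N(N−1−i) = −θ_N(i)`, PROVED below from the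
landed reflection covariance `Theorems/BoundaryKubo/Negative/Reflection.lean` + weak-NESS uniqueness).

THE LINE (three stubs, all over tree vocabulary; `sorry` only there):
* `stub_inwardOrdering`  (S1 = C1q, HARDEST, the lever): on the hot half of a long chain the local
  resistances are quasi-ordered from the contact layer inward — `r_j ≤ r_i + s_i` for
  `i₀ ≤ i ≤ j ≤ (N−2)/2`, with a slack `s_i → 0` (triage r1-3 (2): quasi form) and finitely many
  contact bonds `i < i₀` exempt (triage r1-1/2).
* `stub_lengthMonotone`  (S2 = C3q): at a fixed depth `i ≥ i₁` from the hot contact, lengthening the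
  chain raises the local resistance by at most `η_i`, `η_i → 0` ("the far contact is screened").
* `stub_layerBounded`    (S3): at every fixed depth `j` the local resistance is bounded uniformly in
  the length (two-sided; covers the exempt contact bonds of S1/S2 — triage r1-2 sharpening).
* `BoundedResponseConverges_of : FiniteResponseProfile → ContactIdentity → PositiveConductance →
  BoundedResponseConverges` — KERNEL-CHECKED composition concluding the crux decl BY NAME; its three
  hypotheses are registered route items (stmt-12011, 12015, 11750; fixed-`N`, theorem-grade).

GLUE (proved, `exchange_of_limits`): with `ℓ_d := inf_N r_d^{(N)}` (column infimum at depth `d`)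
and `r_∞ := liminf_d ℓ_d`: S1 + S3 + reflection + series law give
`limsup_N R_N/(N−1) ≤ ℓ_M + η_M + s_M` for every depth `M` (S2 turns the column infimum into an
eventual column supremum up to `η_M`), hence `≤ r_∞`; and EVERY bond of depth `d` in the `N`-chain
dominates its own column infimum, so `liminf_N R_N/(N−1) ≥ r_∞` directly — the card's
"NoMidChainUndershoot" is NOT needed as a hypothesis (sharpening found while proving). Bounded
response (`|D_N| ≤ S`, the crux's hypothesis, used exactly here) gives `1/S ≤ R_N/(N−1)`, whence
`ℓ_M ≥ 1/S − η_M − s_M` uniformly and `r_∞ ≥ 1/S > 0`; `r_∞ < ∞` because deep columns sit below the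
depth-`i₀` column (S1) which is bounded (S3). So `D_N = (N−1)/R_N → 1/r_∞ > 0`.

DISPROOF USED (`Cruxes/BoundedResponseConverges/Disproof.lean`; landed `Negative/LoadBearing.lean`, imported by the
planner's scratch audit `skelcheck-local.lean`, evidence on the item):
`boundedResponseConverges_false_without_bddAbove_harmonic` — honoured: `BddAbove` is consumed in
`exchange_of_limits` (hypothesis `hB`, the floor `1/S`); at the harmonic corner S1–S3 hold (geometric
layers `r_i ∝ 4^{-i}`, kit j008254) and the conclusion is blocked by `BddAbove` alone, as it must be.
`boundedResponseConverges_false_without_unique_gamma_zero` — honoured: uniqueness is consumed by the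
reflection antisymmetry (`profile_reflect`) and by the stubs' frame. `skeleton_insulating_mode` is
excluded by S1 + S3 (the bulk is no more resistive than depth `i₀`, which is bounded:
`R_N/(N−1) ≤ B_{i₀} + s_{i₀} + o(1)`), `skeleton_oscillating_mode` by S1 + S2 (exchange of the spatial
limits). No stub is an instance of a landed Negative lemma (those concern `D`-sequences and parameter
mutations, not profile shape).
-/

noncomputable section

namespace Summit.AtomisticToContinuum.FouriersLaw.Cruxes.BoundedResponseConverges.ComonotoneLocalResistance

open MeasureTheory Filter Topology
open Literature.MathematicalPhysics.KineticTheory.HeatConduction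
open Summit.AtomisticToContinuum.FouriersLaw.Theorems.BoundaryKubo.Negative.Reflection

/-! ## The three stubs (`sorry` lives only here; statements over tree vocabulary only)

Common frame (verbatim the crux's): parameters `ω₂ lam β γ > 0`, weak-NESS uniqueness, a steady
family `μ`, a temperature `T > 0`. A profile at length `N` is any `θ : ℕ → ℝ` whose values `θ i`,
`i < N`, are the limits of the `p_i²` difference quotients; `d` is any limit of the current quotient
(under uniqueness both are THE response objects). Local resistance of bond `i`:
`(θ i − θ (i+1)) · ((N−1)/d)`. -/

/-- **Stub S1 · inwardOrdering (C1q) — HARDEST, the line's lever.** Second-order sign regularity of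
the contact-to-site transfer kernel, in its robust form: there are thresholds `N₀, i₀` and a slack
`s i → 0` such that on the HOT HALF of every chain of length `N ≥ N₀` the local resistances are
quasi-non-increasing from the contact layer inward: `r_j ≤ r_i + s_i` for `i₀ ≤ i ≤ j`, `2j+2 ≤ N`.
Exact benchmarks (card, kit j008254/j008257/j008261/j008263): zero violations beyond one contact bond
in 387 Gaussian chains (harmonic corner: geometric layers; BLL self-consistent chain ν = 1, 0.2, 0.05),
so `s ≡ 0`, `i₀ ≤ 1` there. Size: open-problem (no engine beyond TP₃/Karlin comparison in print). -/
theorem stub_inwardOrdering :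
    ∀ ω₂ lam β γ : ℝ, 0 < ω₂ → 0 < lam → 0 < β → 0 < γ →
    (∀ (N : ℕ) (T_L T_R : ℝ), 0 < T_L → 0 < T_R → ∀ μ ν : Measure (PhaseSpace N),
      (pinnedChain ω₂ lam β γ).IsSteadyState N T_L T_R μ →
      (pinnedChain ω₂ lam β γ).IsSteadyState N T_L T_R ν → μ = ν) →
    ∀ μ : (N : ℕ) → ℝ → ℝ → Measure (PhaseSpace N),
      (∀ (N : ℕ) (T_L T_R : ℝ), 0 < T_L → 0 < T_R →
        (pinnedChain ω₂ lam β γ).IsSteadyState N T_L T_R (μ N T_L T_R)) →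
    ∀ T : ℝ, 0 < T →
      ∃ N₀ i₀ : ℕ, ∃ s : ℕ → ℝ, Tendsto s atTop (𝓝 0) ∧
        ∀ (N : ℕ) (θ : ℕ → ℝ) (d : ℝ), N₀ ≤ N →
          (∀ i : Fin N, Tendsto (fun δ : ℝ =>
            ((∫ x, (x.2 i) ^ 2 ∂(μ N (T + δ / 2) (T - δ / 2))) - ∫ x, (x.2 i) ^ 2 ∂(μ N T T)) / δ)
            (𝓝[≠] 0) (𝓝 (θ i))) →
          Tendsto (fun δ : ℝ =>
            (pinnedChain ω₂ lam β γ).totalCurrent (μ N (T + δ / 2) (T - δ / 2)) / δ) (𝓝[≠] 0) (𝓝 d) →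
          0 < d →
          ∀ i j : ℕ, i₀ ≤ i → i ≤ j → 2 * j + 2 ≤ N →
            (θ j - θ (j + 1)) * (((N : ℝ) - 1) / d) ≤ (θ i - θ (i + 1)) * (((N : ℝ) - 1) / d) + s i := by
  sorry

/-- **Stub S2 · lengthMonotone (C3q) — screening of the far contact.** There are thresholds `N₀, i₁`
and a slack `η i → 0` such that for lengths `N₀ ≤ N ≤ N'` and every depth `i ≥ i₁` lying in the hot
half of the shorter chain (`2i+2 ≤ N`), the local resistance at depth `i` of the LONGER chain exceeds
that of the shorter one by at most `η i`: receding the cold contact never makes a fixed bond more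
resistive, up to a slack vanishing with the depth. Benchmarks (card): pointwise monotone (η = 0) in
the harmonic corner for `i ≥ 1` and in BLL up to transients ≤ 1e-4 at `i = 2…4`. Below local Fourier
(one-sided, no bulk value identified); the `N`-uniform locality content of the line sits here. -/
theorem stub_lengthMonotone :
    ∀ ω₂ lam β γ : ℝ, 0 < ω₂ → 0 < lam → 0 < β → 0 < γ →
    (∀ (N : ℕ) (T_L T_R : ℝ), 0 < T_L → 0 < T_R → ∀ μ ν : Measure (PhaseSpace N),
      (pinnedChain ω₂ lam β γ).IsSteadyState N T_L T_R μ →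
      (pinnedChain ω₂ lam β γ).IsSteadyState N T_L T_R ν → μ = ν) →
    ∀ μ : (N : ℕ) → ℝ → ℝ → Measure (PhaseSpace N),
      (∀ (N : ℕ) (T_L T_R : ℝ), 0 < T_L → 0 < T_R →
        (pinnedChain ω₂ lam β γ).IsSteadyState N T_L T_R (μ N T_L T_R)) →
    ∀ T : ℝ, 0 < T →
      ∃ N₀ i₁ : ℕ, ∃ η : ℕ → ℝ, Tendsto η atTop (𝓝 0) ∧
        ∀ (N N' : ℕ) (θ θ' : ℕ → ℝ) (d d' : ℝ), N₀ ≤ N → N ≤ N' →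
          (∀ i : Fin N, Tendsto (fun δ : ℝ =>
            ((∫ x, (x.2 i) ^ 2 ∂(μ N (T + δ / 2) (T - δ / 2))) - ∫ x, (x.2 i) ^ 2 ∂(μ N T T)) / δ)
            (𝓝[≠] 0) (𝓝 (θ i))) →
          (∀ i : Fin N', Tendsto (fun δ : ℝ =>
            ((∫ x, (x.2 i) ^ 2 ∂(μ N' (T + δ / 2) (T - δ / 2))) - ∫ x, (x.2 i) ^ 2 ∂(μ N' T T)) / δ)
            (𝓝[≠] 0) (𝓝 (θ' i))) →
          Tendsto (fun δ : ℝ =>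
            (pinnedChain ω₂ lam β γ).totalCurrent (μ N (T + δ / 2) (T - δ / 2)) / δ) (𝓝[≠] 0) (𝓝 d) →
          Tendsto (fun δ : ℝ =>
            (pinnedChain ω₂ lam β γ).totalCurrent (μ N' (T + δ / 2) (T - δ / 2)) / δ) (𝓝[≠] 0) (𝓝 d') →
          0 < d → 0 < d' →
          ∀ i : ℕ, i₁ ≤ i → 2 * i + 2 ≤ N →
            (θ' i - θ' (i + 1)) * (((N' : ℝ) - 1) / d') ≤ (θ i - θ (i + 1)) * (((N : ℝ) - 1) / d) + η i := by
  sorry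

/-- **Stub S3 · layerBounded — the contact layer is a finite passive resistor, bond by bond.** At
every fixed depth `j` from the hot contact the local resistance is bounded uniformly in the length:
`|r_j^{(N)}| ≤ B_j` for `N ≥ N₀(j)` (`2j+2 ≤ N`). Upper half = no temperature drop across a
fixed-depth bond without a proportional current (the exempt contact bonds of S1/S2 do not become
insulating; together with S1 this excludes the insulating failure mode); lower half = no fixed bond
pumps heat against the gradient at unbounded rate (TP₂-type, much weaker than a monotone profile).
Benchmarks: every Gaussian column converges (card). Size M–L (N-uniform, but only at fixed depth). -/
theorem stub_layerBounded :
    ∀ ω₂ lam β γ : ℝ, 0 < ω₂ → 0 < lam → 0 < β → 0 < γ →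
    (∀ (N : ℕ) (T_L T_R : ℝ), 0 < T_L → 0 < T_R → ∀ μ ν : Measure (PhaseSpace N),
      (pinnedChain ω₂ lam β γ).IsSteadyState N T_L T_R μ →
      (pinnedChain ω₂ lam β γ).IsSteadyState N T_L T_R ν → μ = ν) →
    ∀ μ : (N : ℕ) → ℝ → ℝ → Measure (PhaseSpace N),
      (∀ (N : ℕ) (T_L T_R : ℝ), 0 < T_L → 0 < T_R →
        (pinnedChain ω₂ lam β γ).IsSteadyState N T_L T_R (μ N T_L T_R)) →
    ∀ T : ℝ, 0 < T → ∀ j : ℕ, ∃ B : ℝ, ∃ N₀ : ℕ,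
        ∀ (N : ℕ) (θ : ℕ → ℝ) (d : ℝ), N₀ ≤ N → 2 * j + 2 ≤ N →
          (∀ i : Fin N, Tendsto (fun δ : ℝ =>
            ((∫ x, (x.2 i) ^ 2 ∂(μ N (T + δ / 2) (T - δ / 2))) - ∫ x, (x.2 i) ^ 2 ∂(μ N T T)) / δ)
            (𝓝[≠] 0) (𝓝 (θ i))) →
          Tendsto (fun δ : ℝ =>
            (pinnedChain ω₂ lam β γ).totalCurrent (μ N (T + δ / 2) (T - δ / 2)) / δ) (𝓝[≠] 0) (𝓝 d) →
          0 < d →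
          |(θ j - θ (j + 1)) * (((N : ℝ) - 1) / d)| ≤ B := by
  sorry

/-! ## Proved glue, part 1: elementary lemmas -/

/-- A real sequence bounded on a tail (where a side condition holds) is bounded wherever the side
condition holds. -/
theorem abs_le_of_tail (f : ℕ → ℝ) (K : ℕ) (B : ℝ) (P : ℕ → Prop)
    (h : ∀ n, K ≤ n → P n → |f n| ≤ B) : ∃ B' : ℝ, ∀ n, P n → |f n| ≤ B' := by
  refine ⟨|B| + ∑ m ∈ Finset.range K, |f m|, fun n hn => ?_⟩
  have hsum : 0 ≤ ∑ m ∈ Finset.range K, |f m| := Finset.sum_nonneg (fun m _ => abs_nonneg _)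
  by_cases hK : K ≤ n
  · have h1 := h n hK hn
    have h2 : B ≤ |B| := le_abs_self B
    linarith
  · have hmem : n ∈ Finset.range K := Finset.mem_range.mpr (by omega)
    have h3 : |f n| ≤ ∑ m ∈ Finset.range K, |f m| :=
      Finset.single_le_sum (fun m _ => abs_nonneg (f m)) hmem
    have h4 : 0 ≤ |B| := abs_nonneg B
    linarith

/-- A convergent real sequence is bounded in absolute value. -/
theorem abs_le_of_tendsto_zero (f : ℕ → ℝ) (hf : Tendsto f atTop (𝓝 0)) : ∃ C : ℝ, ∀ n, |f n| ≤ C := by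
  obtain ⟨K, hK⟩ := Metric.tendsto_atTop.mp hf 1 one_pos
  obtain ⟨C, hC⟩ := abs_le_of_tail f K 1 (fun _ => True) (fun n hn _ => by
    have h := hK n hn
    rw [Real.dist_eq, sub_zero] at h
    exact h.le)
  exact ⟨C, fun n => hC n trivial⟩

/-- Indicator sums over a long range are dominated by the full short sum. -/
theorem sum_indicator_le (n ℓ : ℕ) (g : ℕ → ℝ) (hg : ∀ i, 0 ≤ g i) :
    ∑ i ∈ Finset.range n, (if i < ℓ then g i else 0) ≤ ∑ i ∈ Finset.range ℓ, g i := by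
  rw [← Finset.sum_filter]
  apply Finset.sum_le_sum_of_subset_of_nonneg
  · intro i hi
    rw [Finset.mem_filter] at hi
    exact Finset.mem_range.mpr hi.2
  · intro i _ _
    exact hg i

/-- Term-wise to sum: if every term of a sum over `range n` is at most `x` plus a two-sided boundary
correction (an indicator of the `M` leftmost and `M` rightmost indices, of height `c ≥ 0`), the sum
is at most `n·x + 2·M·c`. -/
theorem sum_le_of_termwise (n M : ℕ) (x c : ℝ) (hc : 0 ≤ c) (f : ℕ → ℝ)
    (h : ∀ b, b < n → f b ≤ x + ((if b < M then c else 0) + (if n - 1 - b < M then c else 0))) :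
    ∑ b ∈ Finset.range n, f b ≤ (n : ℝ) * x + 2 * ((M : ℝ) * c) := by
  set G : ℕ → ℝ := fun e => if e < M then c else 0 with hG
  have step1 : ∑ b ∈ Finset.range n, f b ≤ ∑ b ∈ Finset.range n, (x + (G b + G (n - 1 - b))) :=
    Finset.sum_le_sum fun b hb => h b (Finset.mem_range.mp hb)
  have step2 : ∑ b ∈ Finset.range n, (x + (G b + G (n - 1 - b))) =
      (n : ℝ) * x + (∑ b ∈ Finset.range n, G b + ∑ b ∈ Finset.range n, G (n - 1 - b)) := by
    rw [Finset.sum_add_distrib, Finset.sum_add_distrib, Finset.sum_const, Finset.card_range,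
      nsmul_eq_mul]
  have step3 : ∑ b ∈ Finset.range n, G (n - 1 - b) = ∑ b ∈ Finset.range n, G b :=
    Finset.sum_range_reflect G n
  have step4 : ∑ b ∈ Finset.range n, G b ≤ (M : ℝ) * c := by
    calc ∑ b ∈ Finset.range n, G b ≤ ∑ b ∈ Finset.range M, (fun _ => c) b :=
          sum_indicator_le n M (fun _ => c) (fun _ => hc)
      _ = (M : ℝ) * c := by rw [Finset.sum_const, Finset.card_range, nsmul_eq_mul]
  rw [step2, step3] at step1
  linarith

/-- OHMIC SERIES LAW, abstract form: from the two contact identities `d = γ n (1/2 − θ₀)`,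
`d = γ n (θ₁ + 1/2)` (`n = N − 1`), the bath-to-bath resistance is `n/d = 2/γ + (θ₀ − θ₁)·(n/d)`.
(Ideator 3's `ledger_abstract`, re-proved here so that the line file is self-contained.) -/
theorem ledger_abstract (γ : ℝ) (hγ : γ ≠ 0) (n d θ₀ θ₁ : ℝ) (hn : n ≠ 0) (hd : d ≠ 0)
    (h0 : d = γ * n * (1 / 2 - θ₀)) (h1 : d = γ * n * (θ₁ + 1 / 2)) :
    n / d = 2 / γ + (θ₀ - θ₁) * (n / d) := by
  have hsum : 2 * d = γ * n * (1 + θ₁ - θ₀) := by linear_combination h0 + h1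
  have hγn : γ * n ≠ 0 := mul_ne_zero hγ hn
  have e2 : θ₀ - θ₁ = 1 - 2 * d / (γ * n) := by
    field_simp
    linear_combination hsum
  rw [e2]
  field_simp
  ring

/-! ## Proved glue, part 2: the exchange of the two spatial limits (pure real analysis)

Data: `R N` (bath-to-bath resistance `(N−1)/D_N`), `r N b` (local resistance of bond `b` in the
`N`-chain), a global threshold `Nst ≥ 2`, a depth threshold `ι`, slacks `s, η → 0`, per-depth
bounds `B`. Hypotheses: series law, bounded response `1/S ≤ R N/(N−1)` (the sign of `S` is never
used: the floor is carried through as is), reflection symmetry, S1 (C1q), S2 (C3q), S3.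
Conclusion: `R N/(N−1) → r∞ ≥ 1/S`. -/

/-- **Exchange-of-limits glue (PROVED).** See the module docstring for the argument
(`ℓ_d = inf_N r N d`, `r∞ = liminf_d ℓ_d`; upper bound through one depth `M` via S1 + S2 + S3, lower
bound because every bond dominates its own column infimum; bounded response makes `ℓ` uniformly
bounded below and `r∞ ≥ 1/S`). -/
theorem exchange_of_limits (γ S : ℝ) (R : ℕ → ℝ) (r : ℕ → ℕ → ℝ) (Nst ι : ℕ) (s η B : ℕ → ℝ)
    (hγ : 0 < γ) (hN2 : 2 ≤ Nst)
    (hs : Tendsto s atTop (𝓝 0)) (hη : Tendsto η atTop (𝓝 0))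
    (hL : ∀ N, Nst ≤ N → R N = 2 / γ + ∑ b ∈ Finset.range (N - 1), r N b)
    (hB : ∀ N, Nst ≤ N → 1 / S ≤ R N / ((N : ℝ) - 1))
    (hRefl : ∀ N b, Nst ≤ N → b + 2 ≤ N → r N b = r N (N - 2 - b))
    (hC1 : ∀ N i j, Nst ≤ N → ι ≤ i → i ≤ j → 2 * j + 2 ≤ N → r N j ≤ r N i + s i)
    (hC3 : ∀ N N' i, Nst ≤ N → N ≤ N' → ι ≤ i → 2 * i + 2 ≤ N → r N' i ≤ r N i + η i)
    (hBd : ∀ N j, Nst ≤ N → 2 * j + 2 ≤ N → |r N j| ≤ B j) :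
    ∃ rinf : ℝ, 1 / S ≤ rinf ∧ Tendsto (fun N : ℕ => R N / ((N : ℝ) - 1)) atTop (𝓝 rinf) := by
  -- bounds on the slacks
  obtain ⟨Cs, hCs⟩ := abs_le_of_tendsto_zero s hs
  obtain ⟨Cη, hCη⟩ := abs_le_of_tendsto_zero η hη
  have hCs0 : 0 ≤ Cs := le_trans (abs_nonneg _) (hCs 0)
  -- the columns and their infima
  set ν : ℕ → ℕ := fun e => max Nst (2 * e + 2) with hν
  have hνN : ∀ e, Nst ≤ ν e := fun e => le_max_left _ _
  have hνd : ∀ e, 2 * e + 2 ≤ ν e := fun e => le_max_right _ _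
  have hcol_bdd : ∀ e, BddBelow (Set.range fun n : ℕ => r (n + ν e) e) := by
    intro e
    refine ⟨-B e, ?_⟩
    rintro _ ⟨n, rfl⟩
    have h := hBd (n + ν e) e (le_trans (hνN e) (Nat.le_add_left _ _))
      (le_trans (hνd e) (Nat.le_add_left _ _))
    exact (abs_le.mp h).1
  set ℓ : ℕ → ℝ := fun e => ⨅ n : ℕ, r (n + ν e) e with hℓ
  have hℓ_le : ∀ N e, Nst ≤ N → 2 * e + 2 ≤ N → ℓ e ≤ r N e := by
    intro N e hN he
    have hle : ν e ≤ N := max_le hN he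
    obtain ⟨n, hn⟩ : ∃ n, N = n + ν e := ⟨N - ν e, (Nat.sub_add_cancel hle).symm⟩
    rw [hn]
    exact ciInf_le (hcol_bdd e) n
  -- S2 turns the column infimum into an eventual upper bound
  have hcol_up : ∀ e, ι ≤ e → ∀ ε : ℝ, 0 < ε → ∃ Nε : ℕ, Nst ≤ Nε ∧ 2 * e + 2 ≤ Nε ∧
      ∀ N, Nε ≤ N → r N e ≤ ℓ e + η e + ε := by
    intro e he ε hε
    obtain ⟨n, hn⟩ : ∃ n : ℕ, r (n + ν e) e < ℓ e + ε := by
      apply exists_lt_of_ciInf_lt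
      show ℓ e < ℓ e + ε
      linarith
    refine ⟨n + ν e, le_trans (hνN e) (Nat.le_add_left _ _),
      le_trans (hνd e) (Nat.le_add_left _ _), fun N hN => ?_⟩
    have h := hC3 (n + ν e) N e (le_trans (hνN e) (Nat.le_add_left _ _)) hN he
      (le_trans (hνd e) (Nat.le_add_left _ _))
    linarith
  -- per-depth bound sums
  set Bsum : ℕ → ℝ := fun M => ∑ e ∈ Finset.range M, |B e| with hBsum
  have hBsum_nn : ∀ M, 0 ≤ Bsum M := fun M => Finset.sum_nonneg fun e _ => abs_nonneg _
  have hB_le_Bsum : ∀ M e, e < M → B e ≤ Bsum M := fun M e he =>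
    le_trans (le_abs_self _)
      (Finset.single_le_sum (fun e _ => abs_nonneg (B e)) (Finset.mem_range.mpr he))
  have hB_nn : ∀ e, 0 ≤ B e := fun e =>
    le_trans (abs_nonneg _) (hBd (ν e) e (hνN e) (hνd e))
  -- UPPER ESTIMATE at one depth M
  have hupper : ∀ M N, ι ≤ M → Nst ≤ N → 2 * M + 2 ≤ N →
      R N ≤ 2 / γ + ((N : ℝ) - 1) * (r N M + s M) + 2 * ((M : ℝ) * (Bsum M + |r N M + s M|)) := by
    intro M N hM hN hMN
    set x : ℝ := r N M + s M with hx
    have hot : ∀ e, 2 * e + 2 ≤ N → r N e ≤ x + (if e < M then Bsum M + |x| else 0) := by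
      intro e he
      by_cases heM : e < M
      · have h1 : r N e ≤ B e := (abs_le.mp (hBd N e hN he)).2
        have h2 := hB_le_Bsum M e heM
        rw [if_pos heM]
        linarith [neg_abs_le x]
      · have heM' : M ≤ e := not_lt.mp heM
        have h1 := hC1 N M e hN hM heM' he
        rw [if_neg heM]
        linarith
    have hnn : ∀ e, 0 ≤ (if e < M then Bsum M + |x| else 0) := by
      intro e
      split_ifs
      · have := hBsum_nn M
        have := abs_nonneg x
        linarith
      · exact le_rfl
    have hterm : ∀ b, b < N - 1 → r N b ≤ x + ((if b < M then Bsum M + |x| else 0) +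
        (if N - 1 - 1 - b < M then Bsum M + |x| else 0)) := by
      intro b hb
      have e1 : N - 1 - 1 - b = N - 2 - b := by omega
      rw [e1]
      by_cases hhalf : 2 * b + 2 ≤ N
      · have h1 := hot b hhalf
        have h2 := hnn (N - 2 - b)
        linarith
      · rw [hRefl N b hN (by omega)]
        have h1 := hot (N - 2 - b) (by omega)
        have h2 := hnn b
        linarith
    have hsum := sum_le_of_termwise (N - 1) M x (Bsum M + |x|) (by
      have := hBsum_nn M
      have := abs_nonneg x
      linarith) (fun b => r N b) hterm
    have hN1 : 1 ≤ N := by omega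
    rw [Nat.cast_sub hN1, Nat.cast_one] at hsum
    rw [hL N hN]
    linarith
  -- UPPER BOUND: eventually R N/(N-1) ≤ ℓ M + η M + s M + ε
  have hupper' : ∀ M, ι ≤ M → ∀ ε : ℝ, 0 < ε →
      ∃ N₂ : ℕ, ∀ N, N₂ ≤ N → R N / ((N : ℝ) - 1) ≤ ℓ M + η M + s M + ε := by
    intro M hM ε hε
    obtain ⟨Nε, hNε1, hNε2, hNε⟩ := hcol_up M hM (ε / 2) (by linarith)
    set C : ℝ := 2 / γ + 2 * ((M : ℝ) * (Bsum M + (B M + Cs))) with hC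
    have hC0 : 0 ≤ C := by
      have h1 : 0 < 2 / γ := div_pos two_pos hγ
      have h2 : 0 ≤ (M : ℝ) := Nat.cast_nonneg M
      have h3 : 0 ≤ Bsum M + (B M + Cs) := by
        have := hBsum_nn M
        have := hB_nn M
        linarith
      have h4 : 0 ≤ (M : ℝ) * (Bsum M + (B M + Cs)) := mul_nonneg h2 h3
      linarith
    obtain ⟨K, hK⟩ : ∃ K : ℕ, C / (ε / 2) ≤ (K : ℝ) := exists_nat_ge _
    refine ⟨Nε + K + 2, fun N hN => ?_⟩
    have hNNε : Nε ≤ N := by omega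
    have hNst : Nst ≤ N := le_trans hNε1 hNNε
    have hMN : 2 * M + 2 ≤ N := le_trans hNε2 hNNε
    have hN1 : (0 : ℝ) < (N : ℝ) - 1 := by
      have : (2 : ℝ) ≤ (N : ℝ) := by exact_mod_cast (show 2 ≤ N by omega)
      linarith
    have hKN : (K : ℝ) + 1 ≤ (N : ℝ) - 1 := by
      have : ((K + 2 : ℕ) : ℝ) ≤ (N : ℝ) := by exact_mod_cast (show K + 2 ≤ N by omega)
      push_cast at this
      linarith
    have h1 := hupper M N hM hNst hMN
    have h2 := hNε N hNNε
    -- |x| ≤ B M + Cs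
    have hxabs : |r N M + s M| ≤ B M + Cs := by
      have ha : |r N M| ≤ B M := hBd N M hNst hMN
      have hb : |s M| ≤ Cs := hCs M
      calc |r N M + s M| ≤ |r N M| + |s M| := abs_add_le _ _
        _ ≤ B M + Cs := by linarith
    have hM0 : 0 ≤ (M : ℝ) := Nat.cast_nonneg M
    have h3 : 2 * ((M : ℝ) * (Bsum M + |r N M + s M|)) ≤ 2 * ((M : ℝ) * (Bsum M + (B M + Cs))) := by
      have : (M : ℝ) * (Bsum M + |r N M + s M|) ≤ (M : ℝ) * (Bsum M + (B M + Cs)) :=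
        mul_le_mul_of_nonneg_left (by linarith) hM0
      linarith
    -- R N ≤ (N-1) x + C
    have h4 : R N ≤ ((N : ℝ) - 1) * (r N M + s M) + C := by
      rw [hC]
      linarith
    -- C ≤ (ε/2) (N-1)
    have h5 : C ≤ (ε / 2) * ((N : ℝ) - 1) := by
      have hε2 : 0 < ε / 2 := by linarith
      have := (div_le_iff₀ hε2).mp hK
      nlinarith
    rw [div_le_iff₀ hN1]
    nlinarith
  -- uniform lower bound on the infima (bounded response enters here)
  have hℓ_low : ∀ M, ι ≤ M → 1 / S - Cη - Cs ≤ ℓ M := by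
    intro M hM
    have h : 1 / S ≤ ℓ M + η M + s M := by
      apply le_of_forall_pos_le_add
      intro ε hε
      obtain ⟨N₂, hN₂⟩ := hupper' M hM ε hε
      have h1 := hB (max N₂ Nst) (le_max_right _ _)
      have h2 := hN₂ (max N₂ Nst) (le_max_left _ _)
      linarith
    have hη1 : η M ≤ Cη := le_trans (le_abs_self _) (hCη M)
    have hs1 : s M ≤ Cs := le_trans (le_abs_self _) (hCs M)
    linarith
  -- depth monotonicity of the infima, up to slack
  have hℓ_up : ∀ M e, ι ≤ M → M ≤ e → ℓ e ≤ ℓ M + η M + s M := by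
    intro M e hM hMe
    apply le_of_forall_pos_le_add
    intro ε hε
    obtain ⟨Nε, hNε1, _, hNε⟩ := hcol_up M hM ε hε
    have hN1 : Nε ≤ max Nε (2 * e + 2) := le_max_left _ _
    have hN2 : 2 * e + 2 ≤ max Nε (2 * e + 2) := le_max_right _ _
    have hNst : Nst ≤ max Nε (2 * e + 2) := le_trans hNε1 hN1
    have h1 := hℓ_le (max Nε (2 * e + 2)) e hNst hN2
    have h2 := hC1 (max Nε (2 * e + 2)) M e hNst hM hMe hN2
    have h3 := hNε (max Nε (2 * e + 2)) hN1
    linarith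
  -- the liminf of the infima over depths
  set m₀ : ℝ := 1 / S - Cη - Cs with hm₀
  set Utop : ℝ := ℓ ι + η ι + s ι with hUtop
  set L : ℕ → ℝ := fun n => ℓ (n + ι) with hLdef
  have hL_low : ∀ n, m₀ ≤ L n := fun n => hℓ_low (n + ι) (Nat.le_add_left _ _)
  have hL_up : ∀ n, L n ≤ Utop := fun n => hℓ_up ι (n + ι) le_rfl (Nat.le_add_left _ _)
  set g : ℕ → ℝ := fun J => ⨅ n : ℕ, L (n + J) with hgdef
  have hg_bddBelow : ∀ J, BddBelow (Set.range fun n : ℕ => L (n + J)) := fun J =>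
    ⟨m₀, by rintro _ ⟨n, rfl⟩; exact hL_low _⟩
  have hg_le : ∀ J n, g J ≤ L (n + J) := fun J n => ciInf_le (hg_bddBelow J) n
  have hg_up : ∀ J, g J ≤ Utop := fun J => le_trans (hg_le J 0) (hL_up _)
  have hg_mono : Monotone g := by
    refine monotone_nat_of_le_succ fun J => ?_
    refine le_ciInf fun n => ?_
    have h := hg_le J (n + 1)
    have e : n + 1 + J = n + (J + 1) := by omega
    rw [e] at h
    exact h
  have hg_bddAbove : BddAbove (Set.range g) := ⟨Utop, by rintro _ ⟨J, rfl⟩; exact hg_up J⟩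
  set rinf : ℝ := ⨆ J, g J with hrinf
  have hg_le_rinf : ∀ J, g J ≤ rinf := fun J => le_ciSup hg_bddAbove J
  -- UPPER LIMIT
  have hlim_up : ∀ ε : ℝ, 0 < ε → ∃ N₃ : ℕ, ∀ N, N₃ ≤ N → R N / ((N : ℝ) - 1) ≤ rinf + ε := by
    intro ε hε
    obtain ⟨K₁, hK₁⟩ := Metric.tendsto_atTop.mp hη (ε / 4) (by linarith)
    obtain ⟨K₂, hK₂⟩ := Metric.tendsto_atTop.mp hs (ε / 4) (by linarith)
    obtain ⟨n, hn⟩ : ∃ n : ℕ, L (n + (K₁ + K₂)) < g (K₁ + K₂) + ε / 4 := by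
      apply exists_lt_of_ciInf_lt
      show g (K₁ + K₂) < g (K₁ + K₂) + ε / 4
      linarith
    have hMι : ι ≤ n + (K₁ + K₂) + ι := Nat.le_add_left _ _
    obtain ⟨N₂, hN₂⟩ := hupper' (n + (K₁ + K₂) + ι) hMι (ε / 4) (by linarith)
    refine ⟨N₂, fun N hN => ?_⟩
    have h1 := hN₂ N hN
    have h2 : ℓ (n + (K₁ + K₂) + ι) < g (K₁ + K₂) + ε / 4 := hn
    have h3 : g (K₁ + K₂) ≤ rinf := hg_le_rinf _
    have h4 := hK₁ (n + (K₁ + K₂) + ι) (by omega)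
    have h5 := hK₂ (n + (K₁ + K₂) + ι) (by omega)
    rw [Real.dist_eq, sub_zero] at h4 h5
    have h4' := (abs_lt.mp h4).2
    have h5' := (abs_lt.mp h5).2
    linarith
  -- LOWER LIMIT
  have hlim_low : ∀ ε : ℝ, 0 < ε → ∃ N₄ : ℕ, ∀ N, N₄ ≤ N → rinf - ε ≤ R N / ((N : ℝ) - 1) := by
    intro ε hε
    obtain ⟨J, hJ⟩ : ∃ J : ℕ, rinf - ε / 2 < g J := by
      apply exists_lt_of_lt_ciSup
      show rinf - ε / 2 < rinf
      linarith
    have hdeep : ∀ e, J + ι ≤ e → rinf - ε / 2 ≤ ℓ e := by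
      intro e he
      obtain ⟨n, hn⟩ : ∃ n, e = n + J + ι := ⟨e - J - ι, by omega⟩
      have h1 := hg_le J n
      have h2 : L (n + J) = ℓ e := by
        rw [hn]
      linarith
    set y : ℝ := rinf - ε / 2 with hy
    set J' : ℕ := J + ι with hJ'
    -- term-wise lower bound, summed
    have hlowR : ∀ N, Nst ≤ N → 2 * J' + 2 ≤ N →
        ((N : ℝ) - 1) * y - 2 * ((J' : ℝ) * (Bsum J' + |y|)) ≤ R N := by
      intro N hN hJN
      have hot : ∀ e, 2 * e + 2 ≤ N → -r N e ≤ -y + (if e < J' then Bsum J' + |y| else 0) := by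
        intro e he
        by_cases heJ : e < J'
        · have h1 : -B e ≤ r N e := (abs_le.mp (hBd N e hN he)).1
          have h2 := hB_le_Bsum J' e heJ
          rw [if_pos heJ]
          linarith [le_abs_self y]
        · have heJ' : J' ≤ e := not_lt.mp heJ
          have h1 := hℓ_le N e hN he
          have h2 := hdeep e heJ'
          rw [if_neg heJ]
          linarith
      have hnn : ∀ e, 0 ≤ (if e < J' then Bsum J' + |y| else 0) := by
        intro e
        split_ifs
        · have := hBsum_nn J'
          have := abs_nonneg y
          linarith
        · exact le_rfl
      have hterm : ∀ b, b < N - 1 → -r N b ≤ -y + ((if b < J' then Bsum J' + |y| else 0) +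
          (if N - 1 - 1 - b < J' then Bsum J' + |y| else 0)) := by
        intro b hb
        have e1 : N - 1 - 1 - b = N - 2 - b := by omega
        rw [e1]
        by_cases hhalf : 2 * b + 2 ≤ N
        · have h1 := hot b hhalf
          have h2 := hnn (N - 2 - b)
          linarith
        · rw [hRefl N b hN (by omega)]
          have h1 := hot (N - 2 - b) (by omega)
          have h2 := hnn b
          linarith
      have hsum := sum_le_of_termwise (N - 1) J' (-y) (Bsum J' + |y|) (by
        have := hBsum_nn J'
        have := abs_nonneg y
        linarith) (fun b => -r N b) hterm
      have hN1 : 1 ≤ N := by omega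
      rw [Nat.cast_sub hN1, Nat.cast_one, Finset.sum_neg_distrib] at hsum
      rw [hL N hN]
      have : 0 < 2 / γ := div_pos two_pos hγ
      linarith
    set C : ℝ := 2 * ((J' : ℝ) * (Bsum J' + |y|)) with hC
    have hC0 : 0 ≤ C := by
      have h2 : 0 ≤ (J' : ℝ) := Nat.cast_nonneg J'
      have h3 : 0 ≤ Bsum J' + |y| := by
        have := hBsum_nn J'
        have := abs_nonneg y
        linarith
      have := mul_nonneg h2 h3
      rw [hC]
      linarith
    obtain ⟨K, hK⟩ : ∃ K : ℕ, C / (ε / 2) ≤ (K : ℝ) := exists_nat_ge _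
    refine ⟨Nst + (2 * J' + 2) + K + 2, fun N hN => ?_⟩
    have hNst : Nst ≤ N := by omega
    have hJN : 2 * J' + 2 ≤ N := by omega
    have hN1 : (0 : ℝ) < (N : ℝ) - 1 := by
      have : (2 : ℝ) ≤ (N : ℝ) := by exact_mod_cast (show 2 ≤ N by omega)
      linarith
    have hKN : (K : ℝ) + 1 ≤ (N : ℝ) - 1 := by
      have : ((K + 2 : ℕ) : ℝ) ≤ (N : ℝ) := by exact_mod_cast (show K + 2 ≤ N by omega)
      push_cast at this
      linarith
    have h1 := hlowR N hNst hJN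
    have h5 : C ≤ (ε / 2) * ((N : ℝ) - 1) := by
      have hε2 : 0 < ε / 2 := by linarith
      have := (div_le_iff₀ hε2).mp hK
      nlinarith
    rw [le_div_iff₀ hN1]
    nlinarith
  -- CONVERGENCE and the floor
  have hT : Tendsto (fun N : ℕ => R N / ((N : ℝ) - 1)) atTop (𝓝 rinf) := by
    rw [Metric.tendsto_atTop]
    intro ε hε
    obtain ⟨N₃, hN₃⟩ := hlim_up (ε / 2) (by linarith)
    obtain ⟨N₄, hN₄⟩ := hlim_low (ε / 2) (by linarith)
    refine ⟨max N₃ N₄, fun N hN => ?_⟩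
    have h1 := hN₃ N (le_trans (le_max_left _ _) hN)
    have h2 := hN₄ N (le_trans (le_max_right _ _) hN)
    rw [Real.dist_eq, abs_lt]
    constructor <;> linarith
  have hfloor : 1 / S ≤ rinf :=
    ge_of_tendsto hT (Filter.eventually_atTop.mpr ⟨Nst, fun N hN => hB N hN⟩)
  exact ⟨rinf, hfloor, hT⟩

/-! ## Proved glue, part 3: reflection antisymmetry of the response profile (fixed `N`) -/

/-- **Reflection antisymmetry of the kinetic-temperature response profile (PROVED).** Under
weak-NESS uniqueness, along a steady family, `θ_N(N−1−i) = −θ_N(i)`: the site reflection maps the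
steady state at `(T_L, T_R)` to the steady state at `(T_R, T_L)` (`isSteadyState_map_reflect`,
landed), so `⟨p²_{N−1−i}⟩_{T+δ/2,T−δ/2} = ⟨p_i²⟩_{T−δ/2,T+δ/2}` and the difference quotient at the
reflected site is minus the quotient at `i` evaluated at `−δ`. -/
theorem profile_reflect {ω₂ lam β γ : ℝ}
    (hU : ∀ (N : ℕ) (T_L T_R : ℝ), 0 < T_L → 0 < T_R → ∀ μ' ν' : Measure (PhaseSpace N),
      (pinnedChain ω₂ lam β γ).IsSteadyState N T_L T_R μ' →
        (pinnedChain ω₂ lam β γ).IsSteadyState N T_L T_R ν' → μ' = ν')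
    {μ : (M : ℕ) → ℝ → ℝ → Measure (PhaseSpace M)}
    (hμ : ∀ (N : ℕ) (T_L T_R : ℝ), 0 < T_L → 0 < T_R →
      (pinnedChain ω₂ lam β γ).IsSteadyState N T_L T_R (μ N T_L T_R))
    {T : ℝ} (hT : 0 < T) {N : ℕ} {θ : ℕ → ℝ}
    (hθ : ∀ i : Fin N, Tendsto (fun δ : ℝ =>
      ((∫ x, (x.2 i) ^ 2 ∂(μ N (T + δ / 2) (T - δ / 2))) - ∫ x, (x.2 i) ^ 2 ∂(μ N T T)) / δ)
      (𝓝[≠] 0) (𝓝 (θ i)))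
    (i : ℕ) (hi : i < N) : θ (N - 1 - i) = -θ i := by
  -- second moments along the family
  set m : Fin N → ℝ → ℝ → ℝ := fun k a b => ∫ x, (x.2 k) ^ 2 ∂(μ N a b) with hm
  have hswap : ∀ (k : Fin N) (a b : ℝ), 0 < a → 0 < b → m k b a = m (Fin.rev k) a b := by
    intro k a b ha hb
    have h1 := isSteadyState_map_reflect _ (pinnedChain_V_even ω₂ lam β γ) (hμ N a b ha hb)
    have h2 : μ N b a = (μ N a b).map (reflectCLE N) :=
      hU N b a hb ha _ _ (hμ N b a hb ha) h1
    simp only [hm]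
    rw [h2, measurableEmbedding_reflect.integral_map]
    simp only [reflectCLE_snd]
  have hθ' : ∀ k : Fin N, Tendsto (fun δ : ℝ => (m k (T + δ / 2) (T - δ / 2) - m k T T) / δ)
      (𝓝[≠] 0) (𝓝 (θ k)) := fun k => hθ k
  have hjval : ((Fin.rev (⟨i, hi⟩ : Fin N) : Fin N) : ℕ) = N - 1 - i := by
    rw [Fin.val_rev]
    show N - (i + 1) = N - 1 - i
    omega
  -- negation on the punctured neighbourhood
  have hneg : Tendsto (fun δ : ℝ => -δ) (𝓝[≠] (0 : ℝ)) (𝓝[≠] (0 : ℝ)) := by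
    rw [tendsto_nhdsWithin_iff]
    constructor
    · have h : Tendsto (fun δ : ℝ => -δ) (𝓝 (0 : ℝ)) (𝓝 (0 : ℝ)) := by
        simpa using (continuous_neg.tendsto (0 : ℝ))
      exact h.mono_left nhdsWithin_le_nhds
    · filter_upwards [self_mem_nhdsWithin] with δ hδ
      simpa using hδ
  have h1 : Tendsto (fun δ : ℝ => (m ⟨i, hi⟩ (T + -δ / 2) (T - -δ / 2) - m ⟨i, hi⟩ T T) / -δ)
      (𝓝[≠] 0) (𝓝 (θ ((⟨i, hi⟩ : Fin N) : ℕ))) := (hθ' ⟨i, hi⟩).comp hneg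
  have h2 := h1.neg
  have h3 : (fun δ : ℝ => -((m ⟨i, hi⟩ (T + -δ / 2) (T - -δ / 2) - m ⟨i, hi⟩ T T) / -δ))
      =ᶠ[𝓝[≠] (0 : ℝ)]
      (fun δ : ℝ => (m (Fin.rev ⟨i, hi⟩) (T + δ / 2) (T - δ / 2) - m (Fin.rev ⟨i, hi⟩) T T) / δ) := by
    have hI : Set.Ioo (-(2 * T)) (2 * T) ∈ 𝓝[≠] (0 : ℝ) :=
      nhdsWithin_le_nhds (Ioo_mem_nhds (by linarith) (by linarith))
    filter_upwards [hI] with δ hδ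
    have ha : 0 < T - δ / 2 := by linarith [hδ.2]
    have hb : 0 < T + δ / 2 := by linarith [hδ.1]
    have e1 : m (Fin.rev ⟨i, hi⟩) (T + δ / 2) (T - δ / 2) = m ⟨i, hi⟩ (T - δ / 2) (T + δ / 2) := by
      rw [hswap (Fin.rev ⟨i, hi⟩) (T - δ / 2) (T + δ / 2) ha hb, Fin.rev_rev]
    have e2 : m (Fin.rev ⟨i, hi⟩) T T = m ⟨i, hi⟩ T T := by
      rw [hswap (Fin.rev ⟨i, hi⟩) T T hT hT, Fin.rev_rev]
    rw [e1, e2, show T + -δ / 2 = T - δ / 2 by ring, show T - -δ / 2 = T + δ / 2 by ring,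
      div_neg, neg_neg]
  have h4 : Tendsto (fun δ : ℝ =>
      (m (Fin.rev ⟨i, hi⟩) (T + δ / 2) (T - δ / 2) - m (Fin.rev ⟨i, hi⟩) T T) / δ)
      (𝓝[≠] 0) (𝓝 (-θ ((⟨i, hi⟩ : Fin N) : ℕ))) := h2.congr' h3
  have h5 : θ ((Fin.rev (⟨i, hi⟩ : Fin N) : Fin N) : ℕ) = -θ ((⟨i, hi⟩ : Fin N) : ℕ) :=
    tendsto_nhds_unique (hθ' (Fin.rev ⟨i, hi⟩)) h4
  rw [hjval] at h5
  exact h5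

/-! ## The composition: the three stubs (with three fixed-`N` route items) imply the crux BY NAME -/

/-- **Planner's skeleton theorem (kept verbatim; lead c3 renamed it `_of_items`).**
`FiniteResponseProfile` (stmt-12011) + `ContactIdentity` (stmt-12015) +
`PositiveConductance` (stmt-11750) — three fixed-`N`, theorem-grade route items of the sibling routes
`TransferKernelPositivity` / `FeketeSeriesLaw` — together with the stubs S1–S3 imply
`OddSectorIrreversibility.BoundedResponseConverges`. The crux's own `BddAbove` hypothesis is what
makes the limit resistance finite-and-positive (`exchange_of_limits`, hypothesis `hB`). -/
theorem BoundedResponseConverges_of_items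
    (hFRP : Theses.TransferKernelPositivity.FiniteResponseProfile)
    (hCI : Theses.TransferKernelPositivity.ContactIdentity)
    (hPC : Theses.FeketeSeriesLaw.PositiveConductance) :
    Theses.OddSectorIrreversibility.BoundedResponseConverges := by
  intro ω₂ lam β γ hω hl hβ hγ hU μ hμ T hT D hD hB
  -- the response profiles θ N : ℕ → ℝ
  have hprof := hFRP ω₂ lam β γ hω hl hβ hγ hU μ hμ T hT
  choose θF hθF using hprof
  set θ : ℕ → ℕ → ℝ := fun N i => if h : i < N then θF N ⟨i, h⟩ else 0 with hθdef
  have hθ : ∀ (N : ℕ) (i : Fin N), Tendsto (fun δ : ℝ =>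
      ((∫ x, (x.2 i) ^ 2 ∂(μ N (T + δ / 2) (T - δ / 2))) - ∫ x, (x.2 i) ^ 2 ∂(μ N T T)) / δ)
      (𝓝[≠] 0) (𝓝 (θ N i)) := by
    intro N i
    have e : θ N i = θF N i := by
      show (if h : (i : ℕ) < N then θF N ⟨i, h⟩ else 0) = θF N i
      rw [dif_pos i.isLt]
    rw [e]
    exact hθF N i
  -- positivity of the response and the contact identities
  have hpos : ∀ N, 2 ≤ N → 0 < D N := hPC ω₂ lam β γ hω hl hβ hγ hU μ hμ T hT D hD
  have hci : ∀ (N : ℕ), 2 ≤ N →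
      D N = γ * ((N : ℝ) - 1) * (1 / 2 - θ N 0) ∧ D N = γ * ((N : ℝ) - 1) * (θ N (N - 1) + 1 / 2) := by
    intro N hN
    exact hCI ω₂ lam β γ hω hl hβ hγ hU μ hμ T hT N hN (θ N 0) (θ N (N - 1)) (D N)
      (hθ N ⟨0, by omega⟩) (hθ N ⟨N - 1, by omega⟩) (hD N)
  -- reflection antisymmetry
  have hanti : ∀ (N i : ℕ), i < N → θ N (N - 1 - i) = -θ N i :=
    fun N i hi => profile_reflect hU hμ hT (hθ N) i hi
  -- local resistances and the bath-to-bath resistance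
  set r : ℕ → ℕ → ℝ := fun N b => (θ N b - θ N (b + 1)) * (((N : ℝ) - 1) / D N) with hrdef
  set R : ℕ → ℝ := fun N => ((N : ℝ) - 1) / D N with hRdef
  have hledger : ∀ N, 2 ≤ N → R N = 2 / γ + ∑ b ∈ Finset.range (N - 1), r N b := by
    intro N hN
    obtain ⟨h0, h1⟩ := hci N hN
    have hDpos := hpos N hN
    have hN1 : (0 : ℝ) < (N : ℝ) - 1 := by
      have : (2 : ℝ) ≤ (N : ℝ) := by exact_mod_cast hN
      linarith
    have htel : ∑ b ∈ Finset.range (N - 1), (θ N b - θ N (b + 1)) = θ N 0 - θ N (N - 1) :=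
      Finset.sum_range_sub' (fun b => θ N b) (N - 1)
    show ((N : ℝ) - 1) / D N =
      2 / γ + ∑ b ∈ Finset.range (N - 1), (θ N b - θ N (b + 1)) * (((N : ℝ) - 1) / D N)
    rw [← Finset.sum_mul, htel]
    exact ledger_abstract γ hγ.ne' ((N : ℝ) - 1) (D N) (θ N 0) (θ N (N - 1)) hN1.ne' hDpos.ne' h0 h1
  have hrefl : ∀ N b, 2 ≤ N → b + 2 ≤ N → r N b = r N (N - 2 - b) := by
    intro N b hN hb
    have ha := hanti N (b + 1) (by omega)
    have hb' := hanti N b (by omega)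
    have e1 : N - 1 - (b + 1) = N - 2 - b := by omega
    have e2 : N - 2 - b + 1 = N - 1 - b := by omega
    show (θ N b - θ N (b + 1)) * (((N : ℝ) - 1) / D N) =
      (θ N (N - 2 - b) - θ N (N - 2 - b + 1)) * (((N : ℝ) - 1) / D N)
    rw [e2, ← e1, ha, hb']
    ring
  -- bounded response: 1/S ≤ R N/(N-1)
  obtain ⟨S₀, hS₀⟩ := hB
  set S : ℝ := max S₀ 1 with hSdef
  have hSpos : 0 < S := lt_of_lt_of_le one_pos (le_max_right _ _)
  have hbound : ∀ N, 2 ≤ N → 1 / S ≤ R N / ((N : ℝ) - 1) := by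
    intro N hN
    have hDpos := hpos N hN
    have hDle : D N ≤ S := le_trans (le_trans (le_abs_self _) (hS₀ ⟨N, rfl⟩)) (le_max_left _ _)
    have hN1 : (0 : ℝ) < (N : ℝ) - 1 := by
      have : (2 : ℝ) ≤ (N : ℝ) := by exact_mod_cast hN
      linarith
    have e : R N / ((N : ℝ) - 1) = 1 / D N := by
      show ((N : ℝ) - 1) / D N / ((N : ℝ) - 1) = 1 / D N
      field_simp
    rw [e]
    exact one_div_le_one_div_of_le hDpos hDle
  -- the stubs
  obtain ⟨N₁, i₀, s, hs, hS1⟩ := stub_inwardOrdering ω₂ lam β γ hω hl hβ hγ hU μ hμ T hT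
  obtain ⟨N₂, i₁, η, hη, hS2⟩ := stub_lengthMonotone ω₂ lam β γ hω hl hβ hγ hU μ hμ T hT
  have hS3 := stub_layerBounded ω₂ lam β γ hω hl hβ hγ hU μ hμ T hT
  choose Bf N₀f hBf using hS3
  -- thresholds
  set Nst : ℕ := N₁ + N₂ + 2 with hNst
  set ι : ℕ := i₀ + i₁ with hι
  have hC1 : ∀ N i j, Nst ≤ N → ι ≤ i → i ≤ j → 2 * j + 2 ≤ N → r N j ≤ r N i + s i := by
    intro N i j hN hi hij hj
    exact hS1 N (θ N) (D N) (by omega) (hθ N) (hD N) (hpos N (by omega)) i j (by omega) hij hj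
  have hC3 : ∀ N N' i, Nst ≤ N → N ≤ N' → ι ≤ i → 2 * i + 2 ≤ N → r N' i ≤ r N i + η i := by
    intro N N' i hN hNN' hi hiN
    exact hS2 N N' (θ N) (θ N') (D N) (D N') (by omega) hNN' (hθ N) (hθ N') (hD N) (hD N')
      (hpos N (by omega)) (hpos N' (by omega)) i (by omega) hiN
  have hS3' : ∀ j, ∃ B' : ℝ, ∀ N, (Nst ≤ N ∧ 2 * j + 2 ≤ N) → |r N j| ≤ B' := by
    intro j
    refine abs_le_of_tail (fun N => r N j) (N₀f j) (Bf j) (fun N => Nst ≤ N ∧ 2 * j + 2 ≤ N) ?_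
    intro N hK hP
    exact hBf j N (θ N) (D N) hK hP.2 (hθ N) (hD N) (hpos N (by omega))
  choose B hBd using hS3'
  -- exchange of limits
  obtain ⟨rinf, hrinf, hRT⟩ := exchange_of_limits γ S R r Nst ι s η B hγ (by omega) hs hη
    (fun N hN => hledger N (by omega)) (fun N hN => hbound N (by omega))
    (fun N b hN hb => hrefl N b (by omega) hb) hC1 hC3 (fun N j hN hj => hBd j N ⟨hN, hj⟩)
  -- invert
  have hrpos : 0 < rinf := lt_of_lt_of_le (div_pos one_pos hSpos) hrinf
  refine ⟨rinf⁻¹, inv_pos.mpr hrpos, ?_⟩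
  have hinv := hRT.inv₀ (ne_of_gt hrpos)
  refine hinv.congr' ?_
  refine Filter.eventually_atTop.mpr ⟨2, fun N hN => ?_⟩
  have hDpos := hpos N hN
  have hN1 : (0 : ℝ) < (N : ℝ) - 1 := by
    have : (2 : ℝ) ≤ (N : ℝ) := by exact_mod_cast hN
    linarith
  show (((N : ℝ) - 1) / D N / ((N : ℝ) - 1))⁻¹ = D N
  field_simp

/-! ## Lead c3 reshape: the three by-name hypotheses are LANDED theorems — discharge them -/

/-- `TransferKernelPositivity.FiniteResponseProfile` (stmt-12011) HOLDS: it is the verbatim twin of the landed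
`PuiseuxTransferLedger.FiniteResponseProfile` (`finiteResponseProfile_proof`; definitional transport). -/
theorem finiteResponseProfile_holds : Theses.TransferKernelPositivity.FiniteResponseProfile :=
  fun ω₂ lam β γ hω hl hβ hγ hU μ hμ T hT N i =>
    Theorems.PuiseuxTransferLedgerFiniteResponseProfile.finiteResponseProfile_proof
      ω₂ lam β γ hω hl hβ hγ hU μ hμ T hT N i

/-- `TransferKernelPositivity.ContactIdentity` (stmt-12015) HOLDS (landed, lead c2 of this crux, p102366). -/
theorem contactIdentity_holds : Theses.TransferKernelPositivity.ContactIdentity :=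
  Theorems.transferKernelPositivity_contactIdentity_proof

/-- `FeketeSeriesLaw.PositiveConductance` (stmt-11750) HOLDS (landed, lead 9141-1 of this crux, p96209). -/
theorem positiveConductance_holds : Theses.FeketeSeriesLaw.PositiveConductance :=
  TwoScaleGluingLogRigidity.Stubs.positiveConductance_holds

/-- **Registered composition (lead c3).** The three stubs S1 (`stub_inwardOrdering`), S2 (`stub_lengthMonotone`),
S3 (`stub_layerBounded`) ALONE imply the crux `OddSectorIrreversibility.BoundedResponseConverges`, BY NAME and
unconditionally: the planner's composition with its three fixed-`N` hypotheses discharged by the landed theorems.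
Where the crux's hypotheses are consumed: `BddAbove` in `exchange_of_limits` (floor `1/S`), uniqueness in
`profile_reflect` and in the stubs' frame (cf. `Negative/LoadBearing`). -/
theorem BoundedResponseConverges_of : Theses.OddSectorIrreversibility.BoundedResponseConverges :=
  BoundedResponseConverges_of_items finiteResponseProfile_holds contactIdentity_holds positiveConductance_holds

end Summit.AtomisticToContinuum.FouriersLaw.Cruxes.BoundedResponseConverges.ComonotoneLocalResistance

end
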